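import Summits.ResolutionOfSingularities.ResolutionOfSingularities.Theorems.WildConesCampaignW46HypersurfacesCharTwoEmbDimDefs

/-!
# [OURS · L1 W4.6, rung (ii) at p = 2, EVERY dimension n] DEFINITION: the homogeneous form of degree
# `d` of a power series evaluated at a vector, `degForm` — for `d = 3` the TANGENT CUBIC of the cleaned
# state, whose zeros on the kernel of the polar form are the infinitely-near double points

HONEST FRAMING. Everything here is OURS: one bookkeeping definition over route WildCones' own TYPED
point-blow-up dynamics (`Theorems/WildConesClassicalRegimesDefs.lean`: a state is the coefficient
function `c : (Fin n → ℕ) → κ` of `a = Σ c(A) u^A` in `z^p = a(u₁,…,uₙ)`; `ser` its cleaned power series;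
`step i τ c` = blow up the point, chart `u_i`, translate by `τ`, delete `p`-th powers; `MultP` = double
point). Nothing here is a statement of H. Hironaka's manuscript [Hironaka2017] and nothing of it is used;
no FACT-LIST premise is used. AI bookkeeping, weaker than expert review. Cell res-hironaka
(LADDER-RESOLUTION rung L, D-0089), slot W4.6 «restricted regimes as rungs», seat res-L1-s46-pv-4
(gen 5): «(ii) THREEFOLD HYPERSURFACES, second prover: the p = 2 hyperbolic-splitting regime of
`ClassicalRegimes` (n ≥ 3, order-2 cleaned states)». Host: route `WildCones`, crux `ClassicalRegimes`
(stmt-ResolutionOfSingularities-16884; proved). `--kind definition --supports` that item.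

WHY. Gens 2–4 of this seat located the infinitely-near double points of a double point
`z² = a(u₁,…,uₙ)` (characteristic `2`) COARSELY: the homogeneous coordinate vector
`w = (τ with w_i = 1)` of a double successor `step i τ c` lies in the kernel of the polar form
(`vecMul_nearPoint_polarMatrix`, p503790), which has dimension `e(c)`; for `e ≤ 1` the near double
point is unique and exists iff `μ ≥ 4` (p505045). Gen 5 makes the locus EXACT in every dimension and
every corank: the remaining linear coefficient of the strict transform, the one at the chart variable,
is the degree-3 form of the cleaned state evaluated at `w`,
`[u_i] T = a₃(w) = degForm 3 (ser c) w`
(the coefficient of `u_i³` in `a∘Φ_{i,τ}`), so that a double successor sits at `(i, τ)` iff `w·P = 0`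
and `a₃(w) = 0` (files `…HypersurfacesCharTwoCubicForm.lean`, `…NearLocus.lean` of this seat): the
infinitely-near double points are the points of the projective kernel of the polar form on the cubic
`a₃ = 0`.

No theorem with content is proved here: one definition.

References: G.-M. Greuel, G. Pfister, The splitting lemma in any characteristic, J. Algebra 689 (2026)
= arXiv:2507.17078 [GreuelPfister2026] (context); H. Hironaka, ms. 2017-03-23 [Hironaka2017], Th. 16.6
p.84 — quoted for the ROLE the campaign statements replace, under adjudication, never as fact.
-/

noncomputable section

set_option linter.dupNamespace false -- mandated namespace of this single-conjunct summit

open scoped Classical BigOperators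

open MvPowerSeries

namespace Summit.ResolutionOfSingularities.ResolutionOfSingularities.Theorems

namespace CampaignW46

/-- [OURS · L1 W4.6; NOT a statement of the manuscript] **The degree-`d` form of a power series at a
vector**: for `f ∈ κ⟦X₁,…,Xₙ⟧` and `w : Fin n → κ`,
`degForm d f w = Σ_{|A| = d} [X^A] f · Π_s w_s^{A_s}` — the homogeneous component of degree `d` of `f`
evaluated at `w`. For the cleaned series of a double state in characteristic `2`, `degForm 3 (ser c) w`
is the TANGENT CUBIC at `w`; it is the `u_i`-coefficient of the strict transform at `(i, τ)` when
`w = (τ with w_i = 1)`. [folklore] -/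
def degForm {n : ℕ} {κ : Type} [Field κ] (d : ℕ) (f : MvPowerSeries (Fin n) κ) (w : Fin n → κ) : κ :=
  ∑ A ∈ (Finset.univ : Finset (Fin n)).finsuppAntidiag d, coeff A f * ∏ s, w s ^ (A s)

end CampaignW46

end Summit.ResolutionOfSingularities.ResolutionOfSingularities.Theorems

end
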